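import Mathlib
import HarnessLib

/-!
# Improper integrals on a finite interval: proceeding to the limit (Davis–Rabinowitz 1984, Sect. 2.12.1)

Davis–Rabinowitz, *Methods of Numerical Integration* (2nd ed., 1984), Sect. 2.12 "Improper Integrals (Finite
Interval)", Sect. 2.12.1 "Proceeding to the Limit", p. 140.  For `f` integrable on `(0, 1]` (typically unbounded near
`0`), the definition `∫_0^1 f = lim_{r → 0+} ∫_r^1 f` (2.12.1.1) suggests choosing points `1 = r_0 > r_1 > r_2 > ⋯ → 0`,
for example `r_n = 2^{-n}`, and writing
`∫_0^1 f = ∫_{r_1}^1 f + ∫_{r_2}^{r_1} f + ∫_{r_3}^{r_2} f + ⋯` (2.12.1.2), each integral on the right being proper.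
Recorded: for an antitone sequence `r` with `r 0 = 1` and `r n → 0`, the pieces `(r (n+1), r n]` partition `(0, 1]`
and the series (2.12.1.2) sums (unconditionally) to `∫_0^1 f` for every `f` Lebesgue-integrable on `(0, 1]`; the
partial sums are the proper integrals `I_n = ∫_{r_n}^1 f` of the worked example, which therefore converge to
`∫_0^1 f`; and the dyadic instance `r_n = 2^{-n}`.  (The book's caveat that stopping when one piece is `≤ ε` "is
only a practical criterion and is not correct theoretically" is about the stopping rule, not about (2.12.1.2).)

Provenance: engines group, shared numerical engines serving client cells; rigour lives in the verifiers; every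
published number belongs to a client cell's ledger, not to the engines group.  Textbook facts only (no client
numbers).
-/

namespace Literature.Analysis.Quadrature

open MeasureTheory Set Filter Topology

/-- [folklore] An antitone sequence tending to `0` is nonnegative. -/
private theorem nonneg_of_antitone_tendsto_zero {r : ℕ → ℝ} (hr : Antitone r)
    (hlim : Tendsto r atTop (𝓝 0)) (n : ℕ) : 0 ≤ r n :=
  hr.le_of_tendsto hlim n

/-- The pieces `(r (n+1), r n]` of an antitone sequence with `r 0 = 1`, `r n → 0` cover exactly `(0, 1]`.
[cite: DavisRabinowitz1984, Sect. 2.12.1 (2.12.1.2)] -/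
theorem iUnion_Ioc_succ_eq_Ioc {r : ℕ → ℝ} (hr : Antitone r) (h0 : r 0 = 1)
    (hlim : Tendsto r atTop (𝓝 0)) : (⋃ n, Ioc (r (n + 1)) (r n)) = Ioc 0 1 := by
  ext x
  simp only [mem_iUnion, mem_Ioc]
  constructor
  · rintro ⟨n, h1, h2⟩
    exact ⟨(nonneg_of_antitone_tendsto_zero hr hlim (n + 1)).trans_lt h1,
      h2.trans (h0 ▸ hr (Nat.zero_le n))⟩
  · rintro ⟨hx0, hx1⟩
    have hev : ∃ n, r (n + 1) < x := by
      obtain ⟨n, hn⟩ := ((tendsto_order.1 hlim).2 x hx0).exists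
      exact ⟨n, (hr (Nat.le_succ n)).trans_lt hn⟩
    classical
    refine ⟨Nat.find hev, Nat.find_spec hev, ?_⟩
    rcases Nat.eq_zero_or_pos (Nat.find hev) with h | h
    · rw [h, h0]; exact hx1
    · have := Nat.find_min hev (Nat.sub_one_lt_of_lt h)
      rw [Nat.sub_one_add_one_eq_of_pos h] at this
      exact not_lt.1 this

/-- **Proceeding to the limit** (2.12.1.2): for `f` integrable on `(0, 1]` and points `1 = r_0 ≥ r_1 ≥ ⋯ → 0`,
`Σ_n ∫_{r_{n+1}}^{r_n} f = ∫_0^1 f` (unconditional sum of proper integrals).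
[cite: DavisRabinowitz1984, Sect. 2.12.1 (2.12.1.1)-(2.12.1.2)] -/
theorem hasSum_intervalIntegral_pieces {f : ℝ → ℝ} (hf : IntegrableOn f (Ioc 0 1)) {r : ℕ → ℝ}
    (hr : Antitone r) (h0 : r 0 = 1) (hlim : Tendsto r atTop (𝓝 0)) :
    HasSum (fun n => ∫ x in r (n + 1)..r n, f x) (∫ x in (0:ℝ)..1, f x) := by
  have hU := iUnion_Ioc_succ_eq_Ioc hr h0 hlim
  have h := hasSum_integral_iUnion (μ := volume) (f := f) (s := fun n => Ioc (r (n + 1)) (r n))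
    (fun n => measurableSet_Ioc) (hr.pairwise_disjoint_on_Ioc_succ) (by rw [hU]; exact hf)
  rw [hU] at h
  have hfun : (fun n => ∫ x in Ioc (r (n + 1)) (r n), f x) = fun n => ∫ x in r (n + 1)..r n, f x :=
    funext fun n => (intervalIntegral.integral_of_le (hr (Nat.le_succ n))).symm
  rw [hfun] at h
  rw [intervalIntegral.integral_of_le zero_le_one]
  exact h

/-- The partial sums of (2.12.1.2) are the proper integrals `I_N = ∫_{r_N}^1 f` of the worked example (p. 140).
[cite: DavisRabinowitz1984, Sect. 2.12.1 (2.12.1.2)] -/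
theorem sum_range_intervalIntegral_pieces {f : ℝ → ℝ} (hf : IntegrableOn f (Ioc 0 1)) {r : ℕ → ℝ}
    (hr : Antitone r) (h0 : r 0 = 1) (hlim : Tendsto r atTop (𝓝 0)) (N : ℕ) :
    ∑ n ∈ Finset.range N, ∫ x in r (n + 1)..r n, f x = ∫ x in r N..1, f x := by
  have hint : ∀ a b, a ∈ Icc (0:ℝ) 1 → b ∈ Icc (0:ℝ) 1 → IntervalIntegrable f volume a b := by
    intro a b ha hb
    rw [intervalIntegrable_iff, uIoc]
    exact hf.mono_set (Ioc_subset_Ioc (le_min ha.1 hb.1) (max_le ha.2 hb.2))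
  have hmem : ∀ n, r n ∈ Icc (0:ℝ) 1 := fun n =>
    ⟨nonneg_of_antitone_tendsto_zero hr hlim n, h0 ▸ hr (Nat.zero_le n)⟩
  induction N with
  | zero => simp [h0]
  | succ N ih =>
    rw [Finset.sum_range_succ, ih, add_comm,
      intervalIntegral.integral_add_adjacent_intervals (hint _ _ (hmem _) (hmem _))
        (hint _ _ (hmem _) (h0 ▸ hmem 0))]

/-- Hence `I_N = ∫_{r_N}^1 f → ∫_0^1 f` — the limit (2.12.1.1) along the chosen points.
[cite: DavisRabinowitz1984, Sect. 2.12.1 (2.12.1.1)] -/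
theorem tendsto_intervalIntegral_of_antitone {f : ℝ → ℝ} (hf : IntegrableOn f (Ioc 0 1)) {r : ℕ → ℝ}
    (hr : Antitone r) (h0 : r 0 = 1) (hlim : Tendsto r atTop (𝓝 0)) :
    Tendsto (fun N => ∫ x in r N..1, f x) atTop (𝓝 (∫ x in (0:ℝ)..1, f x)) := by
  have h := (hasSum_intervalIntegral_pieces hf hr h0 hlim).tendsto_sum_nat
  exact h.congr fun N => sum_range_intervalIntegral_pieces hf hr h0 hlim N

/-! ### The dyadic choice `r_n = 2^{-n}` -/

/-- The text's choice `r_n = 2^{-n}` in (2.12.1.2) is antitone (and starts at `r_0 = 1`).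
[cite: DavisRabinowitz1984, Sect. 2.12.1 (2.12.1.2)] -/
theorem antitone_dyadicRadius : Antitone fun n : ℕ => (1 / 2 : ℝ) ^ n :=
  fun _ _ h => pow_le_pow_of_le_one (by norm_num) (by norm_num) h

/-- The text's choice `r_n = 2^{-n}` in (2.12.1.2) tends to `0`. [cite: DavisRabinowitz1984, Sect. 2.12.1 (2.12.1.2)] -/
theorem tendsto_dyadicRadius_zero : Tendsto (fun n : ℕ => (1 / 2 : ℝ) ^ n) atTop (𝓝 0) :=
  tendsto_pow_atTop_nhds_zero_of_lt_one (by norm_num) (by norm_num)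

/-- (2.12.1.2) with `r_n = 2^{-n}`: `Σ_n ∫_{2^{-n-1}}^{2^{-n}} f = ∫_0^1 f` for `f` integrable on `(0, 1]`.
[cite: DavisRabinowitz1984, Sect. 2.12.1 (2.12.1.2)] -/
theorem hasSum_intervalIntegral_dyadic {f : ℝ → ℝ} (hf : IntegrableOn f (Ioc 0 1)) :
    HasSum (fun n : ℕ => ∫ x in (1 / 2 : ℝ) ^ (n + 1)..(1 / 2 : ℝ) ^ n, f x) (∫ x in (0:ℝ)..1, f x) :=
  hasSum_intervalIntegral_pieces hf antitone_dyadicRadius (pow_zero _) tendsto_dyadicRadius_zero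

/-- … and `I_n = ∫_{2^{-n}}^1 f → ∫_0^1 f` (the sequence tabulated on p. 140).
[cite: DavisRabinowitz1984, Sect. 2.12.1 (2.12.1.1)] -/
theorem tendsto_intervalIntegral_dyadic {f : ℝ → ℝ} (hf : IntegrableOn f (Ioc 0 1)) :
    Tendsto (fun N : ℕ => ∫ x in (1 / 2 : ℝ) ^ N..1, f x) atTop (𝓝 (∫ x in (0:ℝ)..1, f x)) :=
  tendsto_intervalIntegral_of_antitone hf antitone_dyadicRadius (pow_zero _) tendsto_dyadicRadius_zero

end Literature.Analysis.Quadrature
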